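/-
Copyright (c) 2026 the pub-hodgecm-mathlib formalisation cell (harness21).  Prover seat hodgecm-mathlib-K2E3-p32 (g0), HCML Track B «K2-LIT» (close-out strike line L4
`stub_StCharTS`), h413 = `stmt-HodgeConjecture-24833`, line `K2_E3_EllipticInputs`, PART «SC» socket (SC-an)₂, the (M5h₂) chain (dealer K2E3-plan (g4) EMIT #1
2026-09-04T14:52:25Z, deal D137): the RANK-FREE half of ★ `K2E3CuspFormCancellationU3Inputs` (K2E3-p21 (g3)), restated at ANY rank `N` for `U(σ, Φ_N)(K)` — torus conjugation,
the shapes of `N` and `N̄`, `hT`, `hnormN`, `hnormNbar`, LEMMA 54, and the two generic conjugation bounds of Harish-Chandra's Theorem 20.  2026-09-04.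
-/
import Summits.HodgeConjecture.HodgeConjecture.Theorems.K2E3CuspFormCancellationU3Torus   -- ★ (T20-e2)-discharge FILE 1 at `Φ₃`: its rank-free `coe_inv_glDiagonal`, `diagonal_mul_mul_diagonal_apply`, `valuation_mul_le_pow_of_le`, `valuation_mul_le_of_v_le_one`; brings ★ (T20-c), the bridge
import Summits.HodgeConjecture.HodgeConjecture.Theorems.F0P3cIwahoriDatumU2Alg         -- ★ ANY-RANK Iwahori algebra: `coe_weylConj_apply`, `coe_weylConj_of_eq_glDiagonal`, `weylLongU_inv_eq`
import Literature.NumberTheory.Automorphic.JacquetNonzeroEmbedsNormalizedInd              -- ★ `torusU_mul_comm` (the diagonal torus of `U(σ, Φ_N)` is commutative)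
import HarnessLib

/-!
# h413 ∕ Track B «K2-LIT», Theorem-20 line — THE RANK-FREE HYPOTHESES OF ★ (T20-e2) `cuspForm_trichotomy_*` FOR `U(σ, Φ_N)(K)`, ANY RANK `N`
# (`hT`, `hnormN`, `hnormNbar`, `h54N`, `h54Nbar`, the conjugate level, the two generic conjugation bounds)  (Harish-Chandra 1970, Part VII §8 Lemmas 54–55 pp. 80–83)

Cell `pub/hodgecm-mathlib`, crux H413 = `stmt-HodgeConjecture-24833`, route of record `HCCMUnconditional`; chair K2-lead (g2), LINE-LEAD∕dealer K2E3-plan (g4),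
architect K2E3-p25 (g3).  THEOREMS ONLY (no `def`, no `instance`, no `notation`, no named-fact hypothesis, no `sorry`); lane `--supports stmt-HodgeConjecture-24833 --as helper`.

THE POINT.  ★ `K2E3CuspFormCancellationU3Inputs` (K2E3-p21 (g3)) discharges the structural hypotheses of the ABSTRACT Theorem 20 (★ (T20-e1)∕(T20-e2)) at `U(σ, Φ₃)(K)` with the
size pinned to `Fin 3`; half of it is rank-free.  The (SC-an)₂ road needs the same at `Φ₂` (FILE 2 `K2E3CuspFormCancellationU2Inputs`, this seat); rather than pin `Fin 2`, this
file states the rank-free half ONCE at any rank `N` (proofs transported verbatim, `3 ↦ N`, the `Φ₃`-only Weyl-conjugation lemmas of ★ `UnitaryGroupRankOneIwahoriDatum` replaced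
by the any-rank ★ `F0P3cIwahoriDatumU2.coe_weylConj_apply` ∕ `coe_weylConj_of_eq_glDiagonal` ∕ `weylLongU_inv_eq`):
* §1 `coe_conj_diag_apply` ∕ `coe_inv_conj_diag_apply` (`(a^{±1} x a^{∓1})_{ij}`); `apply_of_mem_N` ∕ `apply_of_mem_Nbar` (unit diagonal, zero pattern); **`conj_mem_level_of_mem_torusU`**
  (`hT`, ★ `torusU_mul_comm`), **`conj_mem_N_of_mem_torusU`** (`hnormN`), **`conj_mem_Nbar_of_mem_torusU`** (`hnormNbar`); `mem_inf_map_conj_inv_iff` (any group);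
  **`diag_mem_heightBall_iff_forall`** (`diag d ∈ Ω_h ↔ ∀ i, |ϖ^h d_i^{±1}| ≤ 1` — NEW, the rank-free form of ★ U3Torus `diag_mem_heightBall_iff`), and LEMMA 54
  **`mem_heightBall_two_mul_of_mul_mem`** ∕ `_N` ∕ `_Nbar` (`n·a ∈ Ω_c ⇒ n ∈ Ω_{2c}`, now from ALL diagonal entries, so rank-free).
* §2 `valBound_diag_conj_sub_one` (non-expanding root values keep the level), `valBound_diag_inv_conj_sub_one_le_pow` (contracting root values `≤ |ϖ^{h+1}|` send `Ω_c` into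
  level `|ϖ|^j`, `j + c ≤ h + 1`) — any size `n`.
SETTING: `K` a field (`Valued K ℤᵐ⁰` ∕ compatible `ValuativeRel` where valuations occur), `σ : K →+* K`, `J = Φ_N` where `hJ` is taken, `U = ↥(unitaryGroupOfForm σ J)`, an abstract
`Ω : ℕ → Set U` with the height-ball membership `hmem` of ★ `exists_heightBall_compactExhaustion`, `hinv`, `hmul`; `T = (borelTriple σ J hJ).M`, `N = (borelTriple σ J hJ).N`,
`N̄ = N.map (conj w₀)`.  The rank-ONE statements (`A⁺ ∪ A⁻` cover, the four conjugation bounds) stay in ★ U3Inputs (`Φ₃`) and FILE 2 (`Φ₂`).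

HONEST LABEL.  HC_CM is proved only modulo the 7 printed citations (2 remaining named inputs: hLiu418 = `stmt-HodgeConjecture-24832`, h413 = `stmt-HodgeConjecture-24833`)
until rung 0 closes; count-neutral helper.

## References
* [HarishChandra1970] Harish-Chandra (notes by G. van Dijk), *Harmonic Analysis on Reductive p-adic Groups*, LNM 162 (1970), Part VII §2 p. 69; §8 pp. 80–83 (Lemmas 54–55).
* [Casselman1995] W. Casselman, *Introduction to the theory of admissible representations of `p`-adic reductive groups* (1995 notes), Prop. 1.4.3.
* [Rogawski1990] J. D. Rogawski, *Automorphic Representations of Unitary Groups in Three Variables*, Ann. of Math. Stud. 123 (1990), §1.10 p. 9 (`B = MN`, `M`, `w₀`).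
-/

set_option autoImplicit false
set_option linter.dupNamespace false  -- the mandated namespace repeats the single-problem summit's segment (`HodgeConjecture.HodgeConjecture`)

noncomputable section

open scoped MatrixGroups WithZero Pointwise
open ValuativeRel Matrix
open Literature.NumberTheory.Automorphic Literature.NumberTheory.Automorphic.UnitaryGroup

namespace Summit.HodgeConjecture.HodgeConjecture.Cruxes.H413.K2E3CuspFormCancellationInputsAnyRank

/-! ## §1 Entries of torus conjugates; unit diagonals and zero patterns of `N`, `N̄`; `hT`, `hnormN`, `hnormNbar`; Lemma 54; the conjugate level -/

section AnyRank

variable {K : Type*} [Field K] (σ : K →+* K) {N : ℕ} {J : Matrix (Fin N) (Fin N) K}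

/-- `(a x a⁻¹)_{ij} = d_i x_{ij} d_j⁻¹` for `a = diag(d)` (any rank). [cite: HarishChandra1970, Part VII §8 p. 82] -/
theorem coe_conj_diag_apply {a : ↥(unitaryGroupOfForm σ J)} {d : Fin N → Kˣ} (hd : glDiagonal N K d = (a : GL (Fin N) K))
    (x : ↥(unitaryGroupOfForm σ J)) (i j : Fin N) :
    (((a * x * a⁻¹ : ↥(unitaryGroupOfForm σ J)) : GL (Fin N) K) : Matrix (Fin N) (Fin N) K) i j =
      (d i : K) * ((x : GL (Fin N) K) : Matrix (Fin N) (Fin N) K) i j * ((d j : K))⁻¹ := by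
  rw [Subgroup.coe_mul, Subgroup.coe_mul, Subgroup.coe_inv, Units.val_mul, Units.val_mul, ← hd, K2E3CuspFormCancellationU3Torus.coe_inv_glDiagonal, coe_glDiagonal,
    K2E3CuspFormCancellationU3Torus.diagonal_mul_mul_diagonal_apply]

/-- `(a⁻¹ x a)_{ij} = d_i⁻¹ x_{ij} d_j` for `a = diag(d)` (any rank). [cite: HarishChandra1970, Part VII §8 p. 82] -/
theorem coe_inv_conj_diag_apply {a : ↥(unitaryGroupOfForm σ J)} {d : Fin N → Kˣ} (hd : glDiagonal N K d = (a : GL (Fin N) K))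
    (x : ↥(unitaryGroupOfForm σ J)) (i j : Fin N) :
    (((a⁻¹ * x * a : ↥(unitaryGroupOfForm σ J)) : GL (Fin N) K) : Matrix (Fin N) (Fin N) K) i j =
      ((d i : K))⁻¹ * ((x : GL (Fin N) K) : Matrix (Fin N) (Fin N) K) i j * (d j : K) := by
  rw [Subgroup.coe_mul, Subgroup.coe_mul, Subgroup.coe_inv, Units.val_mul, Units.val_mul, ← hd, K2E3CuspFormCancellationU3Torus.coe_inv_glDiagonal, coe_glDiagonal,
    K2E3CuspFormCancellationU3Torus.diagonal_mul_mul_diagonal_apply]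

/-- An element of `N = unipotentU` has unit diagonal and zeros below it (any rank). [cite: Rogawski1990, §1.10 p. 9] -/
theorem apply_of_mem_N (hJ : J = (StdForm.antidiagonal N).over K) {n : ↥(unitaryGroupOfForm σ J)} (hn : n ∈ (borelTriple σ J hJ).N) :
    (∀ i, ((n : GL (Fin N) K) : Matrix (Fin N) (Fin N) K) i i = 1) ∧ ∀ i j : Fin N, j < i → ((n : GL (Fin N) K) : Matrix (Fin N) (Fin N) K) i j = 0 := by
  have hn' : n ∈ unipotentU σ J := hn
  rw [mem_unipotentU_iff] at hn'
  exact ⟨hn'.2, fun i j hji => hn'.1 hji⟩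

/-- An element of `N̄ = w₀ N w₀` has unit diagonal and zeros ABOVE it (`(w₀ u w₀)_{ij} = u_{rev i, rev j}`, `w₀⁻¹ = w₀`; any rank). [cite: Rogawski1990, §1.10 p. 9] -/
theorem apply_of_mem_Nbar (hJ : J = (StdForm.antidiagonal N).over K) {v : ↥(unitaryGroupOfForm σ J)}
    (hv : v ∈ ((borelTriple σ J hJ).N).map (MulAut.conj (weylLongU σ hJ)).toMonoidHom) :
    (∀ i, ((v : GL (Fin N) K) : Matrix (Fin N) (Fin N) K) i i = 1) ∧ ∀ i j : Fin N, i < j → ((v : GL (Fin N) K) : Matrix (Fin N) (Fin N) K) i j = 0 := by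
  have hwinv : (weylLongU σ hJ)⁻¹ = weylLongU σ hJ := F0P3cIwahoriDatumU2.weylLongU_inv_eq σ hJ
  have hw1 : weylLongU σ hJ * weylLongU σ hJ = 1 := mul_eq_one_iff_eq_inv.2 hwinv.symm
  rw [Subgroup.mem_map_equiv, MulAut.conj_symm_apply, hwinv] at hv
  obtain ⟨h1, h0⟩ := apply_of_mem_N σ hJ hv
  have hv_eq : v = weylLongU σ hJ * (weylLongU σ hJ * v * weylLongU σ hJ) * weylLongU σ hJ := by
    rw [← mul_assoc, ← mul_assoc, hw1, one_mul, mul_assoc, hw1, mul_one]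
  refine ⟨fun i => ?_, fun i j hij => ?_⟩
  · conv_lhs => rw [hv_eq]
    rw [F0P3cIwahoriDatumU2.coe_weylConj_apply σ hJ]; exact h1 _
  · conv_lhs => rw [hv_eq]
    rw [F0P3cIwahoriDatumU2.coe_weylConj_apply σ hJ]
    exact h0 _ _ (Fin.rev_lt_rev.2 hij)

/-- **`hT`** (any rank): `a t a⁻¹ = t` for `a, t ∈ T` (the diagonal torus is commutative, ★ `torusU_mul_comm`), so `a (K_γ ⊓ T) a⁻¹ ⊆ K_γ`. [cite: Rogawski1990, §1.10 p. 9] -/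
theorem conj_mem_level_of_mem_torusU (hJ : J = (StdForm.antidiagonal N).over K) (L₀ : Subgroup ↥(unitaryGroupOfForm σ J))
    {a : ↥(unitaryGroupOfForm σ J)} (ha : a ∈ (borelTriple σ J hJ).M)
    {t : ↥(unitaryGroupOfForm σ J)} (ht : t ∈ L₀ ⊓ (borelTriple σ J hJ).M) : a * t * a⁻¹ ∈ L₀ := by
  have hcomm := torusU_mul_comm (σ := σ) (J := J) ⟨a, ha⟩ ⟨t, (Subgroup.mem_inf.1 ht).2⟩
  have h' : a * t = t * a := congrArg Subtype.val hcomm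
  rw [h', mul_inv_cancel_right]
  exact (Subgroup.mem_inf.1 ht).1

/-- **`hnormN`** (any rank): `T` normalises `N` (`(a n a⁻¹)_{ij} = d_i n_{ij} d_j⁻¹` keeps the unit diagonal and the zeros below). [cite: Rogawski1990, §1.10 p. 9] -/
theorem conj_mem_N_of_mem_torusU (hJ : J = (StdForm.antidiagonal N).over K) {a : ↥(unitaryGroupOfForm σ J)} (ha : a ∈ (borelTriple σ J hJ).M)
    {n : ↥(unitaryGroupOfForm σ J)} (hn : n ∈ (borelTriple σ J hJ).N) : a * n * a⁻¹ ∈ (borelTriple σ J hJ).N := by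
  obtain ⟨d, hd⟩ := (mem_torusU_iff a).1 ha
  obtain ⟨h1, h0⟩ := apply_of_mem_N σ hJ hn
  show a * n * a⁻¹ ∈ unipotentU σ J
  rw [mem_unipotentU_iff]
  refine ⟨fun i j hji => ?_, fun i => ?_⟩
  · rw [coe_conj_diag_apply σ hd, h0 i j hji, mul_zero, zero_mul]
  · rw [coe_conj_diag_apply σ hd, h1 i, mul_one, mul_inv_cancel₀ (d i).ne_zero]

/-- **`hnormNbar`** (any rank): `T` normalises `N̄ = w₀ N w₀` (`w₀ a w₀ ∈ T`, `w₀⁻¹ = w₀`; ★ `F0P3cIwahoriDatumU2.coe_weylConj_of_eq_glDiagonal`). [cite: Rogawski1990, §1.10 p. 9] -/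
theorem conj_mem_Nbar_of_mem_torusU (hJ : J = (StdForm.antidiagonal N).over K) {a : ↥(unitaryGroupOfForm σ J)} (ha : a ∈ (borelTriple σ J hJ).M)
    {v : ↥(unitaryGroupOfForm σ J)} (hv : v ∈ ((borelTriple σ J hJ).N).map (MulAut.conj (weylLongU σ hJ)).toMonoidHom) :
    a * v * a⁻¹ ∈ ((borelTriple σ J hJ).N).map (MulAut.conj (weylLongU σ hJ)).toMonoidHom := by
  have hwinv : (weylLongU σ hJ)⁻¹ = weylLongU σ hJ := F0P3cIwahoriDatumU2.weylLongU_inv_eq σ hJ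
  have hw1 : weylLongU σ hJ * weylLongU σ hJ = 1 := mul_eq_one_iff_eq_inv.2 hwinv.symm
  obtain ⟨d, hd⟩ := (mem_torusU_iff a).1 ha
  rw [Subgroup.mem_map_equiv, MulAut.conj_symm_apply, hwinv] at hv ⊢
  have haw : weylLongU σ hJ * a * weylLongU σ hJ ∈ (borelTriple σ J hJ).M :=
    (mem_torusU_iff _).2 ⟨d ∘ Fin.rev, (F0P3cIwahoriDatumU2.coe_weylConj_of_eq_glDiagonal σ hJ hd.symm).symm⟩
  have key : weylLongU σ hJ * (a * v * a⁻¹) * weylLongU σ hJ =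
      (weylLongU σ hJ * a * weylLongU σ hJ) * (weylLongU σ hJ * v * weylLongU σ hJ) * (weylLongU σ hJ * a * weylLongU σ hJ)⁻¹ := by
    rw [_root_.mul_inv_rev, _root_.mul_inv_rev, hwinv]
    calc weylLongU σ hJ * (a * v * a⁻¹) * weylLongU σ hJ
        = weylLongU σ hJ * a * 1 * v * 1 * a⁻¹ * weylLongU σ hJ := by group
      _ = weylLongU σ hJ * a * (weylLongU σ hJ * weylLongU σ hJ) * v * (weylLongU σ hJ * weylLongU σ hJ) * a⁻¹ * weylLongU σ hJ := by rw [hw1]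
      _ = weylLongU σ hJ * a * weylLongU σ hJ * (weylLongU σ hJ * v * weylLongU σ hJ) * (weylLongU σ hJ * (a⁻¹ * weylLongU σ hJ)) := by group
  rw [key]
  exact conj_mem_N_of_mem_torusU σ hJ haw hv

omit σ in
/-- The conjugate level in any group: `k ∈ K₀ ⊓ K₀.map (conj y⁻¹) ↔ k ∈ K₀ ∧ y k y⁻¹ ∈ K₀` (`K₀(y⁻¹) = K₀ ∩ K₀^{y⁻¹}`). [cite: HarishChandra1970, Part VII §8 p. 80] -/
theorem mem_inf_map_conj_inv_iff {G : Type*} [Group G] (K₀ : Subgroup G) (y k : G) :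
    k ∈ K₀ ⊓ K₀.map (MulAut.conj y⁻¹).toMonoidHom ↔ k ∈ K₀ ∧ y * k * y⁻¹ ∈ K₀ := by
  rw [Subgroup.mem_inf, Subgroup.mem_map_equiv, MulAut.conj_symm_apply, inv_inv]

variable [Valued K ℤᵐ⁰] {ϖ : K} (Ω : ℕ → Set ↥(unitaryGroupOfForm σ J))
  (hmem : ∀ (m : ℕ) (g : ↥(unitaryGroupOfForm σ J)), g ∈ Ω m ↔
    (∀ i j, Valued.v (ϖ ^ m * ((g : GL (Fin N) K) : Matrix (Fin N) (Fin N) K) i j) ≤ 1) ∧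
      ∀ i j, Valued.v (ϖ ^ m * (((g : GL (Fin N) K)⁻¹ : GL (Fin N) K) : Matrix (Fin N) (Fin N) K) i j) ≤ 1)
  (hinv : ∀ (m : ℕ) (g : ↥(unitaryGroupOfForm σ J)), g ∈ Ω m → g⁻¹ ∈ Ω m)
  (hmul : ∀ (a b : ℕ) (g h : ↥(unitaryGroupOfForm σ J)), g ∈ Ω a → h ∈ Ω b → g * h ∈ Ω (a + b))

include hmem in
/-- **HEIGHT OF A DIAGONAL ELEMENT, ANY RANK**: for `a = diag(d) ∈ U(σ, J)`, `a ∈ Ω_h ↔ ∀ i, |ϖ^h d_i| ≤ 1 ∧ |ϖ^h d_i⁻¹| ≤ 1` (rank one: ★ U3Torus ∕ U2Torus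
`diag_mem_heightBall_iff`, where `d₀` alone decides). [cite: HarishChandra1970, Part VII §2 p. 69] -/
theorem diag_mem_heightBall_iff_forall {a : ↥(unitaryGroupOfForm σ J)} {d : Fin N → Kˣ} (hd : glDiagonal N K d = (a : GL (Fin N) K)) (h : ℕ) :
    a ∈ Ω h ↔ ∀ i, Valued.v (ϖ ^ h * (d i : K)) ≤ 1 ∧ Valued.v (ϖ ^ h * ((d i : K))⁻¹) ≤ 1 := by
  have hmat : ((a : GL (Fin N) K) : Matrix (Fin N) (Fin N) K) = diagonal fun i => (d i : K) := by rw [← hd, coe_glDiagonal]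
  have hmatinv : (((a : GL (Fin N) K)⁻¹ : GL (Fin N) K) : Matrix (Fin N) (Fin N) K) = diagonal fun i => ((d i : K))⁻¹ := by
    rw [← hd, K2E3CuspFormCancellationU3Torus.coe_inv_glDiagonal]
  rw [hmem, hmat, hmatinv]
  constructor
  · rintro ⟨hA, hB⟩ i
    refine ⟨?_, ?_⟩
    · have := hA i i; rwa [diagonal_apply_eq] at this
    · have := hB i i; rwa [diagonal_apply_eq] at this
  · intro hd'
    refine ⟨fun i j => ?_, fun i j => ?_⟩
    · by_cases hij : i = j
      · subst hij; rw [diagonal_apply_eq]; exact (hd' i).1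
      · rw [diagonal_apply_ne _ hij, mul_zero, map_zero]; exact zero_le
    · by_cases hij : i = j
      · subst hij; rw [diagonal_apply_eq]; exact (hd' i).2
      · rw [diagonal_apply_ne _ hij, mul_zero, map_zero]; exact zero_le

include hmem hinv hmul in
/-- LEMMA 54's input for a unit-diagonal `x` (`x_{ii} = (x⁻¹)_{ii} = 1`), ANY RANK: if `x·a ∈ Ω_c` with `a = diag(d) ∈ T` then `a ∈ Ω_c` (the diagonal of `x a` is `d`, that of
`(x a)⁻¹ = a⁻¹x⁻¹` is `d⁻¹`), hence `x = (x a)·a⁻¹ ∈ Ω_{2c}` («`‖n′‖ ≤ ‖n′a‖‖a⁻¹‖ ≤ ‖n′a‖²»). [cite: HarishChandra1970, Part VII §8 Lemma 54 p. 82] -/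
theorem mem_heightBall_two_mul_of_mul_mem (hJ : J = (StdForm.antidiagonal N).over K) {x a : ↥(unitaryGroupOfForm σ J)}
    (hx1 : ∀ i, ((x : GL (Fin N) K) : Matrix (Fin N) (Fin N) K) i i = 1) (hx1' : ∀ i, (((x : GL (Fin N) K)⁻¹ : GL (Fin N) K) : Matrix (Fin N) (Fin N) K) i i = 1)
    (ha : a ∈ (borelTriple σ J hJ).M) {c : ℕ} (hxa : x * a ∈ Ω c) : x ∈ Ω (2 * c) := by
  obtain ⟨d, hd⟩ := (mem_torusU_iff a).1 ha
  obtain ⟨hA, hB⟩ := (hmem c (x * a)).1 hxa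
  have hmat : ((a : GL (Fin N) K) : Matrix (Fin N) (Fin N) K) = diagonal fun i => (d i : K) := by rw [← hd, coe_glDiagonal]
  have hmatinv : (((a : GL (Fin N) K)⁻¹ : GL (Fin N) K) : Matrix (Fin N) (Fin N) K) = diagonal fun i => ((d i : K))⁻¹ := by
    rw [← hd, K2E3CuspFormCancellationU3Torus.coe_inv_glDiagonal]
  -- the diagonal entries of `x a` and `(x a)⁻¹ = a⁻¹ x⁻¹`
  have haΩ : a ∈ Ω c := by
    refine (diag_mem_heightBall_iff_forall σ Ω hmem hd c).2 fun i => ⟨?_, ?_⟩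
    · have := hA i i
      rwa [Subgroup.coe_mul, Units.val_mul, hmat, mul_diagonal, hx1, one_mul] at this
    · have := hB i i
      rwa [Subgroup.coe_mul, _root_.mul_inv_rev, Units.val_mul, hmatinv, diagonal_mul, hx1', mul_one] at this
  have h2 := hmul c c (x * a) a⁻¹ hxa (hinv c a haΩ)
  rwa [mul_inv_cancel_right, ← two_mul] at h2

include hmem hinv hmul in
/-- **`h54N`** (any rank): `n ∈ N`, `a ∈ T`, `n·a ∈ Ω_c ⇒ n ∈ Ω_{2c}`. [cite: HarishChandra1970, Part VII §8 Lemma 54 p. 82] -/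
theorem mem_heightBall_two_mul_of_mul_mem_N (hJ : J = (StdForm.antidiagonal N).over K) :
    ∀ n ∈ (borelTriple σ J hJ).N, ∀ a ∈ (borelTriple σ J hJ).M, ∀ c : ℕ, n * a ∈ Ω c → n ∈ Ω (2 * c) := by
  intro n hn a ha c hna
  exact mem_heightBall_two_mul_of_mul_mem σ Ω hmem hinv hmul hJ (apply_of_mem_N σ hJ hn).1
    (by have := (apply_of_mem_N σ hJ ((borelTriple σ J hJ).N.inv_mem hn)).1; rwa [Subgroup.coe_inv] at this) ha hna

include hmem hinv hmul in
/-- **`h54Nbar`** (any rank): `v ∈ N̄`, `a ∈ T`, `v·a ∈ Ω_c ⇒ v ∈ Ω_{2c}`. [cite: HarishChandra1970, Part VII §8 Lemma 54 p. 82] -/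
theorem mem_heightBall_two_mul_of_mul_mem_Nbar (hJ : J = (StdForm.antidiagonal N).over K) :
    ∀ v ∈ ((borelTriple σ J hJ).N).map (MulAut.conj (weylLongU σ hJ)).toMonoidHom, ∀ a ∈ (borelTriple σ J hJ).M, ∀ c : ℕ, v * a ∈ Ω c → v ∈ Ω (2 * c) := by
  intro v hv a ha c hva
  exact mem_heightBall_two_mul_of_mul_mem σ Ω hmem hinv hmul hJ (apply_of_mem_Nbar σ hJ hv).1
    (by have := (apply_of_mem_Nbar σ hJ (Subgroup.inv_mem _ hv)).1; rwa [Subgroup.coe_inv] at this) ha hva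

end AnyRank

/-! ## §2 The two generic conjugation bounds (any size `n`) -/

section Bounds

variable {K : Type*} [Field K] [Valued K ℤᵐ⁰] [ValuativeRel K] [(Valued.v : Valuation K ℤᵐ⁰).Compatible] {n : ℕ}

/-- **NON-EXPANDING ROOT VALUES KEEP THE LEVEL** (generic, any size): `X` with unit diagonal, `ValBound γ (X − 1)`, and `|d_i d_j⁻¹| ≤ 1` wherever `X_{ij} ≠ 0` off the diagonal ⇒
`ValBound γ (diag(d)·X·diag(d)⁻¹ − 1)` (print: `(N̄ ∩ K)^a ⊂ ω₀ = K`). [cite: HarishChandra1970, Part VII §8 p. 81] [cite: Casselman1995, Prop. 1.4.3] -/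
theorem valBound_diag_conj_sub_one {γ : ValueGroupWithZero K} {X : Matrix (Fin n) (Fin n) K} (d : Fin n → Kˣ) (hX1 : ∀ i, X i i = 1)
    (hX : ValBound γ (X - 1)) (hr : ∀ i j, i ≠ j → X i j ≠ 0 → Valued.v ((d i : K) * ((d j : K))⁻¹) ≤ 1) :
    ValBound γ ((diagonal (fun i => (d i : K)) * X * diagonal fun i => ((d i : K))⁻¹) - 1) := by
  intro i j
  rw [Matrix.sub_apply, K2E3CuspFormCancellationU3Torus.diagonal_mul_mul_diagonal_apply]
  by_cases hij : i = j
  · subst hij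
    rw [hX1, mul_one, mul_inv_cancel₀ (d i).ne_zero, Matrix.one_apply_eq, sub_self, map_zero]; exact zero_le
  · rw [Matrix.one_apply_ne hij, sub_zero]
    by_cases h0 : X i j = 0
    · rw [h0, mul_zero, zero_mul, map_zero]; exact zero_le
    · have hXij : valuation K (X i j) ≤ γ := by
        have := hX i j; rwa [Matrix.sub_apply, Matrix.one_apply_ne hij, sub_zero] at this
      have e : (d i : K) * X i j * ((d j : K))⁻¹ = X i j * ((d i : K) * ((d j : K))⁻¹) := by ring
      rw [e]
      exact K2E3CuspFormCancellationU3Torus.valuation_mul_le_of_v_le_one hXij (hr i j hij h0)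

/-- **CONTRACTING ROOT VALUES SEND `Ω_c` INTO A DEEP LEVEL** (generic, any size): `X` with unit diagonal, `|ϖ^c X_{ij}| ≤ 1` for all entries, and `|d_i⁻¹ d_j| ≤ |ϖ^{h+1}|` wherever
`X_{ij} ≠ 0` off the diagonal; then for `j₀ + c ≤ h + 1`: `ValBound (valuation ϖ ^ j₀) (diag(d)⁻¹·X·diag(d) − 1)` (Lemma 55's `|a⁻¹n′a − 1| ≤ q^{σ(n′) − ν(a)δ}`).
[cite: HarishChandra1970, Part VII §8 Lemma 55 p. 83] -/
theorem valBound_diag_inv_conj_sub_one_le_pow {ϖ : K} (hϖ : Valued.v ϖ = WithZero.exp (-1 : ℤ)) {X : Matrix (Fin n) (Fin n) K} (d : Fin n → Kˣ) (hX1 : ∀ i, X i i = 1) {c h j₀ : ℕ}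
    (hXΩ : ∀ i j, Valued.v (ϖ ^ c * X i j) ≤ 1) (hr : ∀ i j, i ≠ j → X i j ≠ 0 → Valued.v (((d i : K))⁻¹ * (d j : K)) ≤ Valued.v (ϖ ^ (h + 1)))
    (hjc : j₀ + c ≤ h + 1) :
    ValBound (valuation K ϖ ^ j₀) ((diagonal (fun i => ((d i : K))⁻¹) * X * diagonal fun i => (d i : K)) - 1) := by
  intro i j
  rw [Matrix.sub_apply, K2E3CuspFormCancellationU3Torus.diagonal_mul_mul_diagonal_apply]
  by_cases hij : i = j
  · subst hij
    rw [hX1, mul_one, inv_mul_cancel₀ (d i).ne_zero, Matrix.one_apply_eq, sub_self, map_zero]; exact zero_le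
  · rw [Matrix.one_apply_ne hij, sub_zero]
    by_cases h0 : X i j = 0
    · rw [h0, mul_zero, zero_mul, map_zero]; exact zero_le
    · have e : ((d i : K))⁻¹ * X i j * (d j : K) = X i j * (((d i : K))⁻¹ * (d j : K)) := by ring
      rw [e]
      exact K2E3CuspFormCancellationU3Torus.valuation_mul_le_pow_of_le hϖ (hXΩ i j) (hr i j hij h0) hjc

end Bounds

end Summit.HodgeConjecture.HodgeConjecture.Cruxes.H413.K2E3CuspFormCancellationInputsAnyRank

end
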